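import Mathlib
import HarnessLib
import Summits.AtomisticToContinuum.FouriersLaw.Theses.JunctionLocality
import Summits.AtomisticToContinuum.FouriersLaw.Theorems.JunctionLocalityDefs
import Summits.AtomisticToContinuum.FouriersLaw.Theorems.JunctionLocalityConductanceLowerBoundStubShortTimeDipoleFloorAux3
import Summits.AtomisticToContinuum.FouriersLaw.Theorems.JunctionLocalityConductanceLowerBoundStubShortTimeDipoleFloorAux13
import Summits.AtomisticToContinuum.FouriersLaw.Theorems.JunctionLocalityConductanceLowerBoundStubShortTimeDipoleFloorAux15
import Summits.AtomisticToContinuum.FouriersLaw.Theorems.JunctionLocalityConductanceLowerBoundStubShortTimeDipoleFloorAux16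

/-!
# Short-time dipole floor (stub S of line `kick-dipole-no-collapse`): the `N`-uniform floor of the booked dipole

Closes the registered stub `stub_shortTimeDipoleFloor` of crux `JunctionLocality.ConductanceLowerBound`
(`--supports stmt-AtomisticToContinuum-11749`): for the pinned anharmonic chain (all parameters `> 0`) and `T > 0` there is
`t₁ > 0` such that for every `t₀ ∈ (0, t₁]` the booked dipole `𝔇_N(t₀) = ∫₀^{t₀} 𝒥_N` is bounded below by `m(t₀) = γ t₀²/8 > 0`
for EVERY `N ≥ 2`.

Assembly.  By helper 3 (`helper_kdShortTimeReduction`) it suffices that the contact power pairing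
`Φ_N(s) = ∫ (p_0 ∂_{q_0}H) · κ_s J dμ_T` stays `≥ T²/4` on a window `[0, t₁]` independent of `N` (`contactPowerPairing_floor`).
`Φ_N(s)` is the sum of its bond terms `I_k(s)` (helper 16).  The contact bond carries the whole static value,
`I_0(0) = ∫ a₀ J dμ_T ≥ T²/2` (helper 4), and moves by at most `B√s` (helpers 14–16: the flow displaces each site by `O(√s)` in
`L²(μ_T ⊗ W)` with local constants).  A far bond `k ≥ 1` is symmetrised by the flip of `p_0` (`a₀` odd, `μ_T` invariant) into half
the annealed flip functional, which the LOCAL light cone (helpers 5–13) bounds by `B_f (r s)^k`; the phantom bond `k = N − 1`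
carries no current.  Summing the geometric series, `|Φ_N(s) − T²/2|`-type losses are `≤ B√s + B_f r s ≤ T²/4` for `s ≤ t₁`.
-/

noncomputable section

open MeasureTheory ProbabilityTheory Filter Topology Set
open scoped NNReal ENNReal BigOperators
open Literature.MathematicalPhysics.KineticTheory.HeatConduction
open Literature.Probability.Process
open Summit.AtomisticToContinuum.FouriersLaw.Theorems.JunctionLocality
open Summit.AtomisticToContinuum.FouriersLaw.Theorems

namespace Summit.AtomisticToContinuum.FouriersLaw.Cruxes.ConductanceLowerBound.KickDipoleNoCollapse

/-- The geometric bookkeeping of the far bonds: `Σ_{1 ≤ m < N} (B_f/2) x^m ≤ B_f x` for `0 ≤ x ≤ 1/2`. -/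
theorem farSum_le {Bf x : ℝ} (hBf : 0 ≤ Bf) (hx0 : 0 ≤ x) (hx : x ≤ 1 / 2) (N : ℕ) :
    ∑ m ∈ Finset.range N, (if 1 ≤ m then Bf / 2 * x ^ m else 0) ≤ Bf * x := by
  cases N with
  | zero => simp only [Finset.range_zero, Finset.sum_empty]; positivity
  | succ n =>
    rw [Finset.sum_range_succ', if_neg (by omega), add_zero]
    have e : ∀ i : ℕ, (if 1 ≤ i + 1 then Bf / 2 * x ^ (i + 1) else 0) = Bf / 2 * x * x ^ i := fun i => by
      rw [if_pos (by omega), pow_succ]; ring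
    rw [Finset.sum_congr rfl fun i _ => e i, ← Finset.mul_sum]
    have hgeom : ∑ i ∈ Finset.range n, x ^ i ≤ 2 :=
      (Finset.sum_le_sum fun i _ => pow_le_pow_left₀ hx0 hx i).trans (sum_geometric_two_le n)
    have h0 : 0 ≤ Bf / 2 * x := by positivity
    calc Bf / 2 * x * ∑ i ∈ Finset.range n, x ^ i ≤ Bf / 2 * x * 2 := mul_le_mul_of_nonneg_left hgeom h0
      _ = Bf * x := by ring

/-- **The `N`-uniform floor on the contact power pairing (★S).**  For the pinned anharmonic chain (all parameters `> 0`) and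
`T > 0` there is `t₁ > 0` such that `Φ_N(s) = ∫ (p_0 ∂_{q_0}H) · κ_s J dμ_T ≥ T²/4` for every `N ≥ 2` and `s ∈ [0, t₁]`. -/
theorem contactPowerPairing_floor : ∀ ω₂ lam β γ : ℝ, 0 < ω₂ → 0 < lam → 0 < β → 0 < γ → ∀ T : ℝ, 0 < T → ∃ t₁ : ℝ, 0 < t₁ ∧ ∀ (N : ℕ) (hN : 2 ≤ N), ∀ s ∈ Set.Icc (0:ℝ) t₁, T ^ 2 / 4 ≤ ∫ z, (z.2 ⟨0, by omega⟩ * partialQ ⟨0, by omega⟩ ((pinnedChain ω₂ lam β γ).hamiltonian N) z) * evolve (pinnedChain ω₂ lam β γ) N T (totalCurrentObs (pinnedChain ω₂ lam β γ) N) s z ∂((pinnedChain ω₂ lam β γ).gibbsMeasure N T) := by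
  intro ω₂ lam β γ hω hl hβ hγ T hT
  obtain ⟨B, hB0, hB⟩ := helper_kdContactBondContinuity ω₂ lam β γ hω hl.le hβ.le hγ.le T hT
  obtain ⟨Bf, r, hBf0, hr, hfar⟩ := helper_kdAnnealedFarBond ω₂ lam β γ hω hl.le hβ.le hγ.le T hT
  set t₁ : ℝ := min 1 (min (1 / (2 * r)) (min ((T ^ 2 / (8 * (B + 1))) ^ 2) (T ^ 2 / (8 * (Bf * r + 1))))) with ht₁def
  have ht₁ : 0 < t₁ := by positivity
  refine ⟨t₁, ht₁, fun N hN2 s hs => ?_⟩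
  have hN : 0 < N := by omega
  obtain ⟨hs0, hst⟩ := hs
  have hs1 : s ≤ 1 := hst.trans (min_le_left _ _)
  have hs2 : s ≤ 1 / (2 * r) := hst.trans ((min_le_right _ _).trans (min_le_left _ _))
  have hs3 : s ≤ (T ^ 2 / (8 * (B + 1))) ^ 2 := hst.trans ((min_le_right _ _).trans ((min_le_right _ _).trans (min_le_left _ _)))
  have hs4 : s ≤ T ^ 2 / (8 * (Bf * r + 1)) := hst.trans ((min_le_right _ _).trans ((min_le_right _ _).trans (min_le_right _ _)))
  have hsr : r * s ≤ 1 / 2 := by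
    have h := mul_le_mul_of_nonneg_left hs2 hr.le
    rw [show r * (1 / (2 * r)) = 1 / 2 by field_simp] at h
    exact h
  have hsB : B * Real.sqrt s ≤ T ^ 2 / 8 := by
    have h1 : Real.sqrt s ≤ T ^ 2 / (8 * (B + 1)) := by
      rw [← Real.sqrt_sq (by positivity : (0:ℝ) ≤ T ^ 2 / (8 * (B + 1)))]
      exact Real.sqrt_le_sqrt hs3
    calc B * Real.sqrt s ≤ (B + 1) * Real.sqrt s := by nlinarith [Real.sqrt_nonneg s]
      _ ≤ (B + 1) * (T ^ 2 / (8 * (B + 1))) := mul_le_mul_of_nonneg_left h1 (by positivity)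
      _ = T ^ 2 / 8 := by field_simp
  have hsF : Bf * r * s ≤ T ^ 2 / 8 := by
    have h1 : (Bf * r + 1) * s ≤ T ^ 2 / 8 := by
      have h := mul_le_mul_of_nonneg_left hs4 (by positivity : (0:ℝ) ≤ Bf * r + 1)
      rwa [show (Bf * r + 1) * (T ^ 2 / (8 * (Bf * r + 1))) = T ^ 2 / 8 by field_simp] at h
    nlinarith
  set P := pinnedChain ω₂ lam β γ with hP
  set μ := P.gibbsMeasure N T with hμ
  set i0 : Fin N := ⟨0, hN⟩ with hi0
  set a : PhaseSpace N → ℝ := fun z => z.2 i0 * partialQ i0 (P.hamiltonian N) z with ha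
  set I : Fin N → ℝ := fun k => ∫ z, a z * evolve P N T (P.bondCurrent N k) s z ∂μ with hI
  have hsum : ∫ z, a z * evolve P N T (totalCurrentObs P N) s z ∂μ = ∑ k : Fin N, I k :=
    integral_contactPower_mul_evolve_totalCurrent_eq_sum hω hl hβ hγ hN hT s
  -- the contact bond
  have hnear : T ^ 2 / 2 - B * Real.sqrt s ≤ I i0 := by
    have h1 := abs_integral_contactPower_mul_evolve_sub_le hω hl hβ hγ hN hT hs0 (by positivity) (hB N hN hN2 s hs0 hs1)
    have h2 := integral_contactPower_mul_bondCurrent_zero_ge hω hl hβ hγ hN hT hN2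
    obtain ⟨-, -, -, -, i1, -, i2⟩ := bondCurrent_evolve_facts hω hl hβ hγ hN hT i0 s
    have e : ∫ z, a z * (evolve P N T (P.bondCurrent N i0) s z - P.bondCurrent N i0 z) ∂μ =
        I i0 - ∫ z, a z * P.bondCurrent N i0 z ∂μ := by
      rw [← integral_sub i1 i2]
      exact integral_congr_ae (Eventually.of_forall fun z => by ring)
    rw [e] at h1
    have h3 := (abs_le.1 h1).1
    linarith
  -- the far bonds
  have hfar_k : ∀ k : Fin N, k ≠ i0 → |I k| ≤ (if 1 ≤ k.val then Bf / 2 * (r * s) ^ k.val else 0) := by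
    intro k hk
    have hk1 : 1 ≤ k.val := Nat.one_le_iff_ne_zero.2 (fun h => hk (Fin.ext h))
    rw [if_pos hk1]
    by_cases hkN : k.val + 1 < N
    · have h := abs_integral_contactPower_mul_evolve_le hω hl hβ hγ hN hT k hs0 (D := Bf * (r * s) ^ k.val) (by positivity)
        (hfar N hN hN2 k hkN hk1 s hs0 hs1 (by linarith))
      linarith
    · have hkN' : k.val + 1 = N := by omega
      have hj0 : P.bondCurrent N k = fun _ => 0 := funext (bondCurrent_last P hkN')
      have : I k = 0 := by
        simp only [hI, evolve_def, hj0, integral_zero, mul_zero]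
      rw [this, abs_zero]
      positivity
  have hfarsum : |∑ k ∈ Finset.univ.erase i0, I k| ≤ Bf * r * s := by
    have hc0 : ∀ k : Fin N, 0 ≤ (if 1 ≤ k.val then Bf / 2 * (r * s) ^ k.val else 0) := fun k => by
      split_ifs <;> positivity
    calc |∑ k ∈ Finset.univ.erase i0, I k| ≤ ∑ k ∈ Finset.univ.erase i0, |I k| := Finset.abs_sum_le_sum_abs _ _
      _ ≤ ∑ k ∈ Finset.univ.erase i0, (if 1 ≤ k.val then Bf / 2 * (r * s) ^ k.val else 0) :=
          Finset.sum_le_sum fun k hk => hfar_k k (Finset.ne_of_mem_erase hk)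
      _ ≤ ∑ k : Fin N, (if 1 ≤ k.val then Bf / 2 * (r * s) ^ k.val else 0) :=
          Finset.sum_le_sum_of_subset_of_nonneg (Finset.erase_subset _ _) fun k _ _ => hc0 k
      _ = ∑ m ∈ Finset.range N, (if 1 ≤ m then Bf / 2 * (r * s) ^ m else 0) :=
          Fin.sum_univ_eq_sum_range (fun m => if 1 ≤ m then Bf / 2 * (r * s) ^ m else 0) N
      _ ≤ Bf * (r * s) := farSum_le hBf0 (by positivity) hsr N
      _ = Bf * r * s := by ring
  -- combine
  rw [hsum, ← Finset.add_sum_erase _ _ (Finset.mem_univ i0)]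
  have h4 := (abs_le.1 hfarsum).1
  linarith

/-- **Registered stub `stub_shortTimeDipoleFloor` (S) of line `kick-dipole-no-collapse`, crux
`JunctionLocality.ConductanceLowerBound`: THE `N`-UNIFORM SHORT-TIME FLOOR OF THE BOOKED DIPOLE.**  For the pinned anharmonic chain
(all parameters `> 0`) and `T > 0` there is `t₁ > 0` such that for every `t₀ ∈ (0, t₁]` there is `m > 0` with
`m ≤ 𝔇_N(t₀) = bookedDipole (pinnedChain ω₂ lam β γ) N T t₀` for EVERY `N ≥ 2` (`m = γ t₀²/8`; `contactPowerPairing_floor` +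
`helper_kdShortTimeReduction`). -/
theorem stub_shortTimeDipoleFloor : ∀ ω₂ lam β γ : ℝ, 0 < ω₂ → 0 < lam → 0 < β → 0 < γ → ∀ T : ℝ, 0 < T → ∃ t₁ : ℝ, 0 < t₁ ∧ ∀ t₀ : ℝ, 0 < t₀ → t₀ ≤ t₁ → ∃ m : ℝ, 0 < m ∧ ∀ N : ℕ, 2 ≤ N → m ≤ bookedDipole (pinnedChain ω₂ lam β γ) N T t₀ := by
  intro ω₂ lam β γ hω hl hβ hγ T hT
  obtain ⟨t₁, ht₁, hfloor⟩ := contactPowerPairing_floor ω₂ lam β γ hω hl hβ hγ T hT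
  refine ⟨min t₁ (1 / (2 * γ)), by positivity, fun t₀ ht₀ ht₀le => ?_⟩
  refine ⟨γ * t₀ ^ 2 / 8, by positivity, fun N hN2 => ?_⟩
  have h1 : t₀ ≤ t₁ := ht₀le.trans (min_le_left _ _)
  have h2 : 2 * γ * t₀ ≤ 1 := by
    have h := mul_le_mul_of_nonneg_left (ht₀le.trans (min_le_right _ _)) (by positivity : (0:ℝ) ≤ 2 * γ)
    rwa [show 2 * γ * (1 / (2 * γ)) = 1 by field_simp] at h
  exact helper_kdShortTimeReduction ω₂ lam β γ hω hl hβ hγ T hT t₁ ht₁ hfloor t₀ ht₀ h1 h2 N hN2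

end Summit.AtomisticToContinuum.FouriersLaw.Cruxes.ConductanceLowerBound.KickDipoleNoCollapse

end
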